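import Summits.ResolutionOfSingularities.KangarooAtlas.MizutaniDigitLevels
import HarnessLib

/-!
# Mizutani's conjecture `m(e) = 2p^e − 1` — the DIGIT LEMMA, part A (arrays)

Cell topic `Summits/ResolutionOfSingularities/KangarooAtlas` (pub-rosobs); namespace
`Summit.ResolutionOfSingularities.KangarooAtlas.Mizutani.DigitLemma`.  Second part of the kernel
certificate of the DIGIT LEMMA of MIZUTANI-PROOF-g59 §4 (in-house, AI-written, AI-audited; *AI review is
weaker than expert review*; not a resolution theorem): the note's MULT step and the assembly of two distinct
digit arrays.  `dist` (a prescribed total `y ≤ Σ c_i` can be distributed under capacities `c`), `mult` (with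
two coordinates of positive capacity every `1 ≤ y ≤ Σ c − 1` has two distributions), `weight_of_levels`,
`levelSum`, and `two_fillings` (TWO FILLINGS: for digit capacities `d i l ≤ p − 1` on `s` coordinates and
`e` levels whose level sums satisfy `p^e ≤ M_e`, `F ≤ p^(e−1) − 1`, every `1 ≤ m ≤ p^e − 1` is the weight of
two distinct sub-arrays `t ≤ d`).

References: [Mizutani1973HironakaGroupSchemes] (Remark 2.10; in-house proof §4).
-/

open Finset

namespace Summit.ResolutionOfSingularities.KangarooAtlas.Mizutani.DigitLemma

variable {D : ℕ → ℕ} {p e : ℕ}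

/-- DIST: every `y ≤ ∑_{i<s} c i` is `∑_{i<s} u i` for some `u ≤ c` vanishing from `s` on. [cite: Mizutani1973HironakaGroupSchemes, Remark 2.10 (in-house proof MIZUTANI-PROOF-g59 §4, Digit Lemma)] -/
theorem dist (c : ℕ → ℕ) : ∀ s y, y ≤ ∑ i ∈ range s, c i →
    ∃ u : ℕ → ℕ, (∀ i, u i ≤ c i) ∧ (∀ i, s ≤ i → u i = 0) ∧ ∑ i ∈ range s, u i = y := by
  intro s
  induction s with
  | zero =>
    intro y hy
    have : y = 0 := by simpa using hy
    subst this
    exact ⟨fun _ => 0, fun _ => Nat.zero_le _, fun _ _ => rfl, by simp⟩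
  | succ s ih =>
    intro y hy
    rw [sum_range_succ] at hy
    by_cases hys : y ≤ c s
    · refine ⟨fun i => if i = s then y else 0, ?_, ?_, ?_⟩
      · intro i; by_cases hi : i = s
        · subst hi; simp [hys]
        · simp [hi]
      · intro i hi; have : i ≠ s := by omega
        simp [this]
      · rw [sum_range_succ]; simp
    · push Not at hys
      obtain ⟨u', hu'1, hu'2, hu'3⟩ := ih (y - c s) (by omega)
      refine ⟨fun i => if i = s then c s else u' i, ?_, ?_, ?_⟩
      · intro i; by_cases hi : i = s
        · subst hi; simp
        · simp [hi, hu'1 i]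
      · intro i hi; have : i ≠ s := by omega
        simp [this, hu'2 i (by omega)]
      · rw [sum_range_succ]; simp
        have : ∑ i ∈ range s, (if i = s then c s else u' i) = ∑ i ∈ range s, u' i := by
          apply sum_congr rfl; intro i hi
          have : i ≠ s := by simp at hi; omega
          simp [this]
        rw [this, hu'3]; omega

/-- MULT: with two coordinates of positive capacity, every `1 ≤ y ≤ ∑ c - 1` has two
distinct distributions `u ≠ u'` (`u, u' ≤ c`, both summing to `y`). [cite: Mizutani1973HironakaGroupSchemes, Remark 2.10 (in-house proof MIZUTANI-PROOF-g59 §4, Digit Lemma)] -/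
theorem mult (c : ℕ → ℕ) (s : ℕ) (hc : ∀ i, s ≤ i → c i = 0) {a b : ℕ} (hab : a ≠ b)
    (ha : 1 ≤ c a) (hb : 1 ≤ c b) {y : ℕ} (hy1 : 1 ≤ y) (hy2 : y + 1 ≤ ∑ i ∈ range s, c i) :
    ∃ u u' : ℕ → ℕ, u ≠ u' ∧ (∀ i, u i ≤ c i) ∧ (∀ i, u' i ≤ c i) ∧
      ∑ i ∈ range s, u i = y ∧ ∑ i ∈ range s, u' i = y := by
  classical
  obtain ⟨u, hu1, hu2, hu3⟩ := dist c s y (by omega)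
  -- a donor i₁ (u i₁ ≥ 1) and a distinct receiver i₂ (u i₂ < c i₂)
  have hpair : ∃ i₁ i₂, i₁ ≠ i₂ ∧ 1 ≤ u i₁ ∧ u i₂ < c i₂ := by
    by_contra H
    push Not at H
    -- some coordinate is nonzero
    have hex0 : ∃ i₀, u i₀ ≠ 0 := by
      by_contra h0; push Not at h0
      have : ∑ i ∈ range s, u i = 0 := sum_eq_zero (fun i _ => h0 i)
      omega
    obtain ⟨i₀, hi₀⟩ := hex0
    -- some coordinate is not full
    have hex2 : ∃ i₂, u i₂ < c i₂ := by
      by_contra h2; push Not at h2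
      have : ∑ i ∈ range s, c i ≤ ∑ i ∈ range s, u i := sum_le_sum (fun i _ => h2 i)
      omega
    obtain ⟨i₂, hi₂⟩ := hex2
    have h02 : i₂ = i₀ := by
      by_contra hne
      exact absurd hi₂ (Nat.not_lt.mpr (H i₀ i₂ (Ne.symm hne) (Nat.one_le_iff_ne_zero.mpr hi₀)))
    subst h02
    -- every other coordinate has capacity 0
    have hzero : ∀ i, i ≠ i₂ → c i = 0 := by
      intro i hi
      have hfull : c i ≤ u i := H i₂ i (Ne.symm hi) (Nat.one_le_iff_ne_zero.mpr hi₀)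
      by_contra hci
      have : 1 ≤ u i := by omega
      exact absurd hi₂ (Nat.not_lt.mpr (H i i₂ hi this))
    rcases eq_or_ne a i₂ with h | h
    · have := hzero b (by rw [← h]; exact Ne.symm hab); omega
    · have := hzero a h; omega
  obtain ⟨i₁, i₂, hne, h1, h2⟩ := hpair
  have hi₁s : i₁ < s := by
    by_contra h; push Not at h; have := hu2 i₁ h; omega
  have hi₂s : i₂ < s := by
    by_contra h; push Not at h; have := hc i₂ h; omega
  let u' : ℕ → ℕ := fun i => if i = i₁ then u i₁ - 1 else if i = i₂ then u i₂ + 1 else u i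
  refine ⟨u, u', ?_, hu1, ?_, hu3, ?_⟩
  · intro heq
    have := congrFun heq i₁
    simp [u'] at this
    omega
  · intro i
    by_cases hi1 : i = i₁
    · subst hi1; simp [u']; have := hu1 i; omega
    · by_cases hi2 : i = i₂
      · subst hi2; simp [u', hi1]; omega
      · simp [u', hi1, hi2, hu1 i]
  · have hpt : ∀ i, u' i + (if i = i₁ then 1 else 0) = u i + (if i = i₂ then 1 else 0) := by
      intro i
      by_cases hi1 : i = i₁
      · subst hi1; have : i ≠ i₂ := hne; simp [u', this]; omega
      · by_cases hi2 : i = i₂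
        · subst hi2; simp [u', hi1]
        · simp [u', hi1, hi2]
    have hsum := sum_congr (rfl : range s = range s) (fun i (_ : i ∈ range s) => hpt i)
    rw [sum_add_distrib, sum_add_distrib, hu3] at hsum
    rw [sum_ite_eq' (range s) i₁, sum_ite_eq' (range s) i₂] at hsum
    simp [mem_range.mpr hi₁s, mem_range.mpr hi₂s] at hsum
    exact hsum

/-- the weight of a filling assembled from per-level distributions. [folklore] -/
lemma weight_of_levels {s : ℕ} (u : ℕ → ℕ → ℕ) (j : ℕ → ℕ)
    (hu : ∀ l, ∑ i ∈ range s, u l i = j l) :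
    ∑ i ∈ range s, ∑ l ∈ range e, u l i * p ^ l = ∑ l ∈ range e, j l * p ^ l := by
  rw [sum_comm]
  apply sum_congr rfl
  intro l _
  rw [← sum_mul, hu l]

/-- level sums of a capacity array [cite: Mizutani1973HironakaGroupSchemes, Remark 2.10 (in-house proof MIZUTANI-PROOF-g59 §4, Digit Lemma)] -/
def levelSum (d : ℕ → ℕ → ℕ) (s : ℕ) : ℕ → ℕ := fun l => ∑ i ∈ range s, d i l

/-- TWO FILLINGS (the Digit Lemma in array form).  Capacities `d i l ≤ p - 1` on the box
`i < s, l < e` (zero outside), level sums `D`, with `p^e ≤ M e` ("`|N| ≥ q`") and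
`F ≤ p^(e-1) - 1` ("`floor N ≤ p^(e-1) - 1`"): every weight `1 ≤ m ≤ p^e - 1` is carried by two
distinct fillings `t ≠ t'`, `t, t' ≤ d`. [cite: Mizutani1973HironakaGroupSchemes, Remark 2.10 (in-house proof MIZUTANI-PROOF-g59 §4, Digit Lemma)] -/
theorem two_fillings (hp : 2 ≤ p) {s : ℕ} (d : ℕ → ℕ → ℕ) (hd : ∀ i l, d i l ≤ p - 1)
    (hds : ∀ i l, s ≤ i → d i l = 0) (hde : ∀ i l, e ≤ l → d i l = 0)
    (hW : p ^ e ≤ M (levelSum d s) p e) (hF : F (levelSum d s) p e ≤ p ^ (e - 1) - 1)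
    {m : ℕ} (hm1 : 1 ≤ m) (hm2 : m + 1 ≤ p ^ e) :
    ∃ t t' : ℕ → ℕ → ℕ, t ≠ t' ∧ (∀ i l, t i l ≤ d i l) ∧ (∀ i l, t' i l ≤ d i l) ∧
      ∑ i ∈ range s, ∑ l ∈ range e, t i l * p ^ l = m ∧
      ∑ i ∈ range s, ∑ l ∈ range e, t' i l * p ^ l = m := by
  classical
  set D := levelSum d s with hDdef
  obtain ⟨j, hj, hcases⟩ := level_main hp hW hF hm1 (by omega : m + 1 ≤ M D p e)
  -- per-level distributions for any representation
  have hlift : ∀ (j : ℕ → ℕ), Rep D p e j m → ∃ u : ℕ → ℕ → ℕ,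
      (∀ l i, u l i ≤ d i l) ∧ (∀ l, ∑ i ∈ range s, u l i = j l) := by
    intro j hj
    have : ∀ l, ∃ v : ℕ → ℕ, (∀ i, v i ≤ d i l) ∧ (∀ i, s ≤ i → v i = 0) ∧ ∑ i ∈ range s, v i = j l :=
      fun l => dist (fun i => d i l) s (j l) (hj.le l)
    choose v hv using this
    exact ⟨v, fun l i => (hv l).1 i, fun l => (hv l).2.2⟩
  rcases hcases with ⟨j', hj', hne⟩ | ⟨h1, h2⟩
  · -- two distinct representations: lift both
    obtain ⟨u, hu1, hu2⟩ := hlift j hj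
    obtain ⟨u', hu'1, hu'2⟩ := hlift j' hj'
    refine ⟨fun i l => u l i, fun i l => u' l i, ?_, fun i l => hu1 l i, fun i l => hu'1 l i, ?_, ?_⟩
    · intro heq
      apply hne
      funext l
      have hl : ∑ i ∈ range s, u l i = ∑ i ∈ range s, u' l i := by
        apply sum_congr rfl; intro i _
        have := congrFun (congrFun heq i) l
        exact this
      rw [hu2 l, hu'2 l] at hl
      exact hl.symm
    · rw [weight_of_levels u j hu2, hj.sum]
    · rw [weight_of_levels u' j' hu'2, hj'.sum]
  · -- one representation with 1 ≤ j 0 ≤ D 0 - 1: two level-0 distributions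
    have he : 1 ≤ e := by
      by_contra he; push Not at he
      have : e = 0 := by omega
      subst this; simp at hm2; omega
    have hD0 : p ≤ D 0 := by
      rcases Nat.lt_or_ge 1 e with he2 | he1
      · have := key hp hW hF (le_refl 1) he2
        simpa [M_succ, M_zero] using this
      · have : e = 1 := by omega
        subst this
        simpa [M_succ, M_zero] using hW
    -- two coordinates with positive level-0 capacity
    have htwo : ∃ a b, a ≠ b ∧ 1 ≤ d a 0 ∧ 1 ≤ d b 0 := by
      by_contra H
      push Not at H
      have hexa : ∃ a, d a 0 ≠ 0 := by
        by_contra h0; push Not at h0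
        have : D 0 = 0 := sum_eq_zero (fun i _ => h0 i)
        omega
      obtain ⟨a, ha⟩ := hexa
      have hothers : ∀ b, b ≠ a → d b 0 = 0 := by
        intro b hb
        by_contra hb0
        exact absurd (H a b (Ne.symm hb) (Nat.one_le_iff_ne_zero.mpr ha)) (by omega)
      have : D 0 = d a 0 := by
        show ∑ i ∈ range s, d i 0 = d a 0
        have has : a < s := by
          by_contra h; push Not at h; exact ha (hds a 0 h)
        rw [sum_eq_single a (fun b _ hb => hothers b hb) (fun h => absurd (mem_range.mpr has) h)]
      have := hd a 0
      omega
    obtain ⟨a, b, hab, ha, hb⟩ := htwo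
    obtain ⟨v, v', hvne, hv1, hv'1, hv2, hv'2⟩ :=
      mult (fun i => d i 0) s (fun i hi => hds i 0 hi) hab ha hb h1 h2
    obtain ⟨u, hu1, hu2⟩ := hlift j hj
    let w : ℕ → ℕ → ℕ := fun l => if l = 0 then v else u l
    let w' : ℕ → ℕ → ℕ := fun l => if l = 0 then v' else u l
    have hw2 : ∀ l, ∑ i ∈ range s, w l i = j l := by
      intro l; by_cases hl : l = 0
      · subst hl; simp [w, hv2]
      · simp [w, hl, hu2 l]
    have hw'2 : ∀ l, ∑ i ∈ range s, w' l i = j l := by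
      intro l; by_cases hl : l = 0
      · subst hl; simp [w', hv'2]
      · simp [w', hl, hu2 l]
    refine ⟨fun i l => w l i, fun i l => w' l i, ?_, ?_, ?_, ?_, ?_⟩
    · intro heq
      apply hvne
      funext i
      have := congrFun (congrFun heq i) 0
      simpa [w, w'] using this
    · intro i l; by_cases hl : l = 0
      · subst hl; simp [w, hv1 i]
      · simp [w, hl, hu1 l i]
    · intro i l; by_cases hl : l = 0
      · subst hl; simp [w', hv'1 i]
      · simp [w', hl, hu1 l i]
    · rw [weight_of_levels w j hw2, hj.sum]
    · rw [weight_of_levels w' j hw'2, hj.sum]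


/-! ## Part N: base-`p` digits and the Digit Lemma for exponent vectors `N` -/


end Summit.ResolutionOfSingularities.KangarooAtlas.Mizutani.DigitLemma
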